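import Mathlib
import Literature.MathematicalPhysics.QuantumLattice.ThinSectorFoldOneSided
import HarnessLib

/-!
# Four-sector counting, fold ranges: the SIGNED key bound along an anti-diagonal and the one-sided ROW KILL

Topic `Literature/MathematicalPhysics/QuantumLattice`; sub-namespace `BandSectorCounting` (continues `HubbardBandSectorCountingToolbox`,
`ThinSectorFoldOneSided`).  Part (F3a) of the log-free ANISOTROPIC anchored four-sector counting lemma («E1-P2-THIN-COUNT», cell gate-hubbard-kl, plan
g17 (R41); seat p4; plan HOME/prover-p4/E1-P2-THIN-COUNT-PLAN.md §Refinement 4).  The Toolbox's `even_key` (BGM 2006 App. A2, the even shift) is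
SIGN-BLIND: along the anti-diagonal `F(t) = h(θ₁; σ − t/2, σ + t/2)` it gives `(h_min/2)·t ≤ |F′(t)|`.  Inside its proof the sign of `F′` is the ALIGNMENT
sign `s` of the momentum sum `S` with the curve point `p(σ)` (`s·(sin S_x, sin S_y) ≈ (sin x(σ), sin y(σ))`): `s·F′(t) ≤ −(h_min/2)·t`.  Aligned
(`s = +1`) is the FORWARD type (`S ≡ p(σ)`, `F` decreasing: hyperbolic contact), anti-aligned (`s = −1`) the umklapp-CORNER type (`S ≡ 2πG − p(σ)`, `F`
increasing: elliptic contact; COUNTING-NOTE-3).  Reading `s` off the diagonal alignment functional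
`I₀(σ) = sin S_x(σ,σ)·sin x(σ) + sin S_y(σ,σ)·sin y(σ)` (`|I₀| ≥ ρ_min² − O(η₀ + λ + τ)` whenever the key hypotheses hold, so its sign is robust):

* **`even_key_signed`** — under the hypotheses of `even_key`, `ι ≤ s·I₀(σ)` with `3 s_max τ < ι` and `2ε₃ < ρ_min²`: `s·F′(t) ≤ −(h_min/2)·t`;
* **`row_kill_anti`** — if `δ₀ + δ₁τ < D(σ) = h(σ,σ) ≤ η₀/2`, `|G(σ, 0)| = |D′(σ)| ≤ 2λ`, `ι ≤ −I₀(σ)` and `2A₂τ² ≤ η₀/2`, `(8s_max² + 4A₂)τ ≤ 2λ`, then the key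
  hypotheses hold on the WHOLE row, `F′ ≥ 0` on `[0, τ]`, and by `gridCount_oneSided_incr` NO cell `t = (i+1)w ≤ τ` of the row is admissible at the affine
  tolerance `δ₀ + δ₁t` — the corner rows with `D(σ) > δ` carry no cells (instead of the sign-blind `2δ√(2M)/(c√D(σ))/w + 1` whose sum is the spurious
  `N log N`); **`row_kill_aligned`** — the mirror (`D(σ) < −(δ₀ + δ₁τ)`, `ι ≤ I₀(σ)`, `F′ ≤ 0`).

Everything is PROVED; no definitions, no named facts.

## Sources

* G. Benfatto, A. Giuliani, V. Mastropietro, Ann. Henri Poincaré 7 (2006) 809–898, Lemma 3.1, App. A2 (even shift). [BenfattoGiulianiMastropietro2006]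
* V. Mastropietro, *Non-Perturbative Renormalization* (World Scientific, 2008), ch. 14, (14.67) p. 223; p. 229. [Mastropietro2008]
-/

noncomputable section

open Real Set
open Literature.MathematicalPhysics.QuantumLattice

namespace Literature.MathematicalPhysics.QuantumLattice.BandSectorCounting

section Signed

variable {a b : ℝ} (B : BandBounds a b) {μ : ℝ} (hμ : μ ∈ Icc a b)
include B hμ

/-- The momentum sum along the anti-diagonal stays within `s_max·t` of its diagonal value: `|S_x(σ−t/2, σ+t/2) − S_x(σ,σ)| ≤ s_max·|t|` (and for `S_y`).
[cite: BenfattoGiulianiMastropietro2006, App. A2] -/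
theorem abs_SX_anti_sub_diag_le (θ₁ σ t : ℝ) :
    |SX μ θ₁ (σ - t / 2) (σ + t / 2) - SX μ θ₁ σ σ| ≤ B.smax * |t| ∧
    |SY μ θ₁ (σ - t / 2) (σ + t / 2) - SY μ θ₁ σ σ| ≤ B.smax * |t| := by
  have hs := B.smax_pos
  have e1 : SX μ θ₁ (σ - t / 2) (σ + t / 2) - SX μ θ₁ σ σ = (bandX μ (σ - t / 2) - bandX μ σ) + (bandX μ (σ + t / 2) - bandX μ σ) := by
    unfold SX; ring
  have e2 : SY μ θ₁ (σ - t / 2) (σ + t / 2) - SY μ θ₁ σ σ = (bandY μ (σ - t / 2) - bandY μ σ) + (bandY μ (σ + t / 2) - bandY μ σ) := by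
    unfold SY; ring
  have ht : |σ - t / 2 - σ| = |t| / 2 := by
    rw [show σ - t / 2 - σ = -(t / 2) by ring, abs_neg, abs_div, abs_two]
  have ht' : |σ + t / 2 - σ| = |t| / 2 := by
    rw [show σ + t / 2 - σ = t / 2 by ring, abs_div, abs_two]
  have h1 := abs_bandX_sub_le B hμ (σ - t / 2) σ
  have h2 := abs_bandX_sub_le B hμ (σ + t / 2) σ
  have h3 := abs_bandY_sub_le B hμ (σ - t / 2) σ
  have h4 := abs_bandY_sub_le B hμ (σ + t / 2) σ
  rw [ht] at h1 h3; rw [ht'] at h2 h4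
  constructor
  · rw [e1]; refine (abs_add_le _ _).trans ?_; linarith
  · rw [e2]; refine (abs_add_le _ _).trans ?_; linarith

/-- **The signed key bound** (the sign-aware `even_key`): along `F(t) = h(θ₁; σ − t/2, σ + t/2)`, `0 < t ≤ τ`, if `|F(t)| ≤ η₀`, `|G(σ,t)| ≤ 4λ`,
the smallness of `even_key` holds together with `2ε₃ < ρ_min²` (`ε₃ = η₀/Dt_min + s_max·ε₂`, `ε₂ = C_g(λ + A₂τ + 2s_max η₀/Dt_min) + τ/2`), and the
diagonal alignment functional satisfies `ι ≤ s·I₀(σ)` for a sign `s = ±1` with `3 s_max τ < ι`, then `s·F′(t) ≤ −(h_min/2)·t`.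
[cite: BenfattoGiulianiMastropietro2006, App. A2] -/
theorem even_key_signed {θ₁ σ t τ η₀ lam ι s : ℝ} (hs01 : s = 1 ∨ s = -1) (ht0 : 0 < t) (htτ : t ≤ τ)
    (hlo : a ≤ μ - η₀) (hhi : μ + η₀ ≤ b)
    (hh : |hfun μ θ₁ (σ - t / 2) (σ + t / 2)| ≤ η₀) (hG : |Gfun μ θ₁ σ t| ≤ 4 * lam)
    (hsmall : 2 * B.A2 * (η₀ / B.Dtmin + B.smax * (B.Cg * (lam + B.A2 * τ + 2 * B.smax * (η₀ / B.Dtmin)) + τ / 2)) ≤ B.hmin / 2)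
    (hρ : 2 * (η₀ / B.Dtmin + B.smax * (B.Cg * (lam + B.A2 * τ + 2 * B.smax * (η₀ / B.Dtmin)) + τ / 2)) < B.rhomin ^ 2)
    (hI : ι ≤ s * (Real.sin (SX μ θ₁ σ σ) * Real.sin (bandX μ σ) + Real.sin (SY μ θ₁ σ σ) * Real.sin (bandY μ σ)))
    (hι : 3 * B.smax * τ < ι) :
    s * (Real.sin (SX μ θ₁ (σ - t / 2) (σ + t / 2)) * (bandVX μ (σ + t / 2) - bandVX μ (σ - t / 2)) +
        Real.sin (SY μ θ₁ (σ - t / 2) (σ + t / 2)) * (bandVY μ (σ + t / 2) - bandVY μ (σ - t / 2))) ≤ -(B.hmin / 2) * t := by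
  obtain ⟨h1, h2⟩ := B.level hμ
  have hsm := B.smax_pos; have hA := B.A2_pos; have hCg := B.Cg_pos; have hD := B.Dtmin_pos
  have hη₀ : 0 ≤ η₀ := (abs_nonneg _).trans hh
  have hlam : 0 ≤ lam := by linarith [abs_nonneg (Gfun μ θ₁ σ t)]
  have hτ : 0 < τ := ht0.trans_le htτ
  have hsabs : |s| = 1 := by rcases hs01 with rfl | rfl <;> norm_num
  have hs2 : s * s = 1 := by rcases hs01 with rfl | rfl <;> norm_num
  set Sx := SX μ θ₁ (σ - t / 2) (σ + t / 2) with hSx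
  set Sy := SY μ θ₁ (σ - t / 2) (σ + t / 2) with hSy
  have hh' : |eps2 Sx Sy - μ| ≤ η₀ := by unfold hfun at hh; exact hh
  obtain ⟨φ, hsx, hsy, -, -⟩ := exists_near_curve_trig B hμ hh' hlo hhi
  -- `|sin Sx X'(σ) + sin Sy Y'(σ)| ≤ λ + A τ` (verbatim from `even_key`)
  have hvm := abs_bandVX_sub_le B hμ (σ - t / 2) σ
  have hvp := abs_bandVX_sub_le B hμ (σ + t / 2) σ
  have hwm := abs_bandVY_sub_le B hμ (σ - t / 2) σ
  have hwp := abs_bandVY_sub_le B hμ (σ + t / 2) σ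
  rw [show σ - t / 2 - σ = -(t / 2) by ring, abs_neg, abs_of_pos (by linarith : 0 < t / 2)] at hvm hwm
  rw [show σ + t / 2 - σ = t / 2 by ring, abs_of_pos (by linarith : 0 < t / 2)] at hvp hwp
  have hmid : |Real.sin Sx * bandVX μ σ + Real.sin Sy * bandVY μ σ| ≤ lam + B.A2 * τ := by
    have hG' : |Real.sin Sx * (bandVX μ (σ - t / 2) + bandVX μ (σ + t / 2)) +
        Real.sin Sy * (bandVY μ (σ - t / 2) + bandVY μ (σ + t / 2))| ≤ 2 * lam := by
      unfold Gfun at hG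
      rw [show 2 * (Real.sin Sx * (bandVX μ (σ - t / 2) + bandVX μ (σ + t / 2))) +
          2 * (Real.sin Sy * (bandVY μ (σ - t / 2) + bandVY μ (σ + t / 2))) =
          2 * (Real.sin Sx * (bandVX μ (σ - t / 2) + bandVX μ (σ + t / 2)) +
            Real.sin Sy * (bandVY μ (σ - t / 2) + bandVY μ (σ + t / 2))) by ring, abs_mul, abs_two] at hG
      linarith
    have hdiff : |Real.sin Sx * (bandVX μ (σ - t / 2) + bandVX μ (σ + t / 2)) +
        Real.sin Sy * (bandVY μ (σ - t / 2) + bandVY μ (σ + t / 2)) -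
        2 * (Real.sin Sx * bandVX μ σ + Real.sin Sy * bandVY μ σ)| ≤ B.A2 * t + B.A2 * t := by
      rw [show Real.sin Sx * (bandVX μ (σ - t / 2) + bandVX μ (σ + t / 2)) +
        Real.sin Sy * (bandVY μ (σ - t / 2) + bandVY μ (σ + t / 2)) -
        2 * (Real.sin Sx * bandVX μ σ + Real.sin Sy * bandVY μ σ) =
        Real.sin Sx * ((bandVX μ (σ - t / 2) - bandVX μ σ) + (bandVX μ (σ + t / 2) - bandVX μ σ)) +
        Real.sin Sy * ((bandVY μ (σ - t / 2) - bandVY μ σ) + (bandVY μ (σ + t / 2) - bandVY μ σ)) by ring]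
      refine (abs_two_term_le (Real.abs_sin_le_one _) ((abs_add_le _ _).trans (add_le_add hvm hvp))
        (Real.abs_sin_le_one _) ((abs_add_le _ _).trans (add_le_add hwm hwp))).trans ?_
      linarith
    have := abs_sub_abs_le_abs_sub (2 * (Real.sin Sx * bandVX μ σ + Real.sin Sy * bandVY μ σ))
      (Real.sin Sx * (bandVX μ (σ - t / 2) + bandVX μ (σ + t / 2)) + Real.sin Sy * (bandVY μ (σ - t / 2) + bandVY μ (σ + t / 2)))
    rw [abs_sub_comm] at this
    rw [abs_mul, abs_two] at this
    nlinarith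
  have k1 : |Real.sin (bandX μ φ) * bandVX μ σ + Real.sin (bandY μ φ) * bandVY μ σ| ≤
      lam + B.A2 * τ + 2 * B.smax * (η₀ / B.Dtmin) := (cross_perturb B hμ hsx hsy).trans (by linarith)
  obtain ⟨j, hj⟩ := exists_int_near_of_cross_small B hμ k1
  -- MVT for the frozen-coefficient function on `[σ - t/2, σ + t/2]`
  have hfd : ∀ x, HasDerivAt (fun x => Real.sin Sx * bandVX μ x + Real.sin Sy * bandVY μ x)
      (Real.sin Sx * bandAX μ x + Real.sin Sy * bandAY μ x) x := fun x =>
    ((hasDerivAt_bandVX h1 h2 x).const_mul (Real.sin Sx)).fun_add ((hasDerivAt_bandVY h1 h2 x).const_mul (Real.sin Sy))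
  obtain ⟨ξ, hξ, hslope⟩ := exists_slope hfd (σ - t / 2) t
  rw [show σ - t / 2 + t = σ + t / 2 by ring] at hslope
  have hval : Real.sin Sx * (bandVX μ (σ + t / 2) - bandVX μ (σ - t / 2)) +
      Real.sin Sy * (bandVY μ (σ + t / 2) - bandVY μ (σ - t / 2)) = t * (Real.sin Sx * bandAX μ ξ + Real.sin Sy * bandAY μ ξ) := by
    rw [← hslope]; ring
  have hξσ : |ξ - σ| ≤ τ / 2 := by
    rw [min_eq_left ht0.le, max_eq_right ht0.le] at hξ
    rw [abs_le]; constructor <;> linarith [hξ.1, hξ.2]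
  set ε₂ := B.Cg * (lam + B.A2 * τ + 2 * B.smax * (η₀ / B.Dtmin)) + τ / 2 with hε₂
  have halign : |φ - ξ - j * π| ≤ ε₂ := by
    calc |φ - ξ - j * π| = |(φ - σ - j * π) + (σ - ξ)| := by ring_nf
      _ ≤ |φ - σ - j * π| + |σ - ξ| := abs_add_le _ _
      _ ≤ B.Cg * (lam + B.A2 * τ + 2 * B.smax * (η₀ / B.Dtmin)) + τ / 2 := add_le_add hj (by rw [abs_sub_comm]; exact hξσ)
  obtain ⟨σ', hσ', ax, ay, -, -⟩ := exists_sign_align B hμ halign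
  have hσabs : |σ'| = 1 := by rcases hσ' with rfl | rfl <;> norm_num
  have hσ2 : σ' * σ' = 1 := by rcases hσ' with rfl | rfl <;> norm_num
  set ε₃ := η₀ / B.Dtmin + B.smax * ε₂ with hε₃
  have cx : |σ' * Real.sin Sx - Real.sin (bandX μ ξ)| ≤ ε₃ := by
    calc |σ' * Real.sin Sx - Real.sin (bandX μ ξ)|
        = |σ' * (Real.sin Sx - Real.sin (bandX μ φ)) + (σ' * Real.sin (bandX μ φ) - Real.sin (bandX μ ξ))| := by ring_nf
      _ ≤ |σ' * (Real.sin Sx - Real.sin (bandX μ φ))| + |σ' * Real.sin (bandX μ φ) - Real.sin (bandX μ ξ)| := abs_add_le _ _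
      _ ≤ η₀ / B.Dtmin + B.smax * ε₂ := by rw [abs_mul, hσabs, one_mul]; exact add_le_add hsx ax
  have cy : |σ' * Real.sin Sy - Real.sin (bandY μ ξ)| ≤ ε₃ := by
    calc |σ' * Real.sin Sy - Real.sin (bandY μ ξ)|
        = |σ' * (Real.sin Sy - Real.sin (bandY μ φ)) + (σ' * Real.sin (bandY μ φ) - Real.sin (bandY μ ξ))| := by ring_nf
      _ ≤ |σ' * (Real.sin Sy - Real.sin (bandY μ φ))| + |σ' * Real.sin (bandY μ φ) - Real.sin (bandY μ ξ)| := abs_add_le _ _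
      _ ≤ η₀ / B.Dtmin + B.smax * ε₂ := by rw [abs_mul, hσabs, one_mul]; exact add_le_add hsy ay
  have hε₃0 : 0 ≤ ε₃ := (abs_nonneg _).trans cx
  have hε₃ρ : 2 * ε₃ < B.rhomin ^ 2 := by rw [hε₃, hε₂]; exact hρ
  -- (1) the sign produced by the alignment lemma IS `s`: both make the alignment functional positive
  have hsinX := B.abs_VX_le μ hμ  -- (only `smax` positivity is used below)
  -- `σ'·J ≥ ρ_min² − 2ε₃ > 0` for `J = sin Sx·sin x(ξ) + sin Sy·sin y(ξ)`
  set J := Real.sin Sx * Real.sin (bandX μ ξ) + Real.sin Sy * Real.sin (bandY μ ξ) with hJ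
  have hρξ : B.rhomin ^ 2 ≤ Real.sin (bandX μ ξ) ^ 2 + Real.sin (bandY μ ξ) ^ 2 := by
    have h0 := B.rho_ge μ hμ ξ
    have hρ0 := B.rhomin_pos
    calc B.rhomin ^ 2 ≤ (Real.sqrt (Real.sin (bandX μ ξ) ^ 2 + Real.sin (bandY μ ξ) ^ 2)) ^ 2 := by gcongr
      _ = Real.sin (bandX μ ξ) ^ 2 + Real.sin (bandY μ ξ) ^ 2 := Real.sq_sqrt (by positivity)
  have hσJ : 0 < σ' * J := by
    have e : σ' * J = Real.sin (bandX μ ξ) ^ 2 + Real.sin (bandY μ ξ) ^ 2 +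
        ((σ' * Real.sin Sx - Real.sin (bandX μ ξ)) * Real.sin (bandX μ ξ) +
          (σ' * Real.sin Sy - Real.sin (bandY μ ξ)) * Real.sin (bandY μ ξ)) := by rw [hJ]; ring
    have b := abs_two_term_le cx (Real.abs_sin_le_one (bandX μ ξ)) cy (Real.abs_sin_le_one (bandY μ ξ))
    have b' := neg_abs_le ((σ' * Real.sin Sx - Real.sin (bandX μ ξ)) * Real.sin (bandX μ ξ) +
          (σ' * Real.sin Sy - Real.sin (bandY μ ξ)) * Real.sin (bandY μ ξ))
    rw [e]; linarith [hρξ, hε₃ρ, b, b']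
  -- `s·J ≥ ι − 3 s_max τ > 0`: compare `J` with the diagonal functional `I₀(σ)`
  have hsJ : 0 < s * J := by
    set I₀ := Real.sin (SX μ θ₁ σ σ) * Real.sin (bandX μ σ) + Real.sin (SY μ θ₁ σ σ) * Real.sin (bandY μ σ) with hI₀
    obtain ⟨dX, dY⟩ := abs_SX_anti_sub_diag_le B hμ θ₁ σ t
    rw [abs_of_pos ht0, ← hSx] at dX; rw [abs_of_pos ht0, ← hSy] at dY
    have sX : |Real.sin Sx - Real.sin (SX μ θ₁ σ σ)| ≤ B.smax * t := (Real.abs_sin_sub_sin_le _ _).trans dX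
    have sY : |Real.sin Sy - Real.sin (SY μ θ₁ σ σ)| ≤ B.smax * t := (Real.abs_sin_sub_sin_le _ _).trans dY
    have xξ : |Real.sin (bandX μ ξ) - Real.sin (bandX μ σ)| ≤ B.smax * (τ / 2) :=
      (Real.abs_sin_sub_sin_le _ _).trans ((abs_bandX_sub_le B hμ ξ σ).trans (mul_le_mul_of_nonneg_left hξσ hsm.le))
    have yξ : |Real.sin (bandY μ ξ) - Real.sin (bandY μ σ)| ≤ B.smax * (τ / 2) :=
      (Real.abs_sin_sub_sin_le _ _).trans ((abs_bandY_sub_le B hμ ξ σ).trans (mul_le_mul_of_nonneg_left hξσ hsm.le))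
    -- `J − I₀ = (sin Sx − sin Sx⁰)·sin xξ + sin Sx⁰·(sin xξ − sin xσ) + (same for y)`
    have e : J - I₀ = (Real.sin Sx - Real.sin (SX μ θ₁ σ σ)) * Real.sin (bandX μ ξ) +
        (Real.sin Sy - Real.sin (SY μ θ₁ σ σ)) * Real.sin (bandY μ ξ) +
        (Real.sin (SX μ θ₁ σ σ) * (Real.sin (bandX μ ξ) - Real.sin (bandX μ σ)) +
          Real.sin (SY μ θ₁ σ σ) * (Real.sin (bandY μ ξ) - Real.sin (bandY μ σ))) := by rw [hJ, hI₀]; ring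
    have b1 := abs_two_term_le sX (Real.abs_sin_le_one (bandX μ ξ)) sY (Real.abs_sin_le_one (bandY μ ξ))
    have b2 := abs_two_term_le (Real.abs_sin_le_one (SX μ θ₁ σ σ)) xξ (Real.abs_sin_le_one (SY μ θ₁ σ σ)) yξ
    have hJI : |J - I₀| ≤ 3 * B.smax * τ := by
      rw [e]
      refine (abs_add_le _ _).trans ?_
      have : B.smax * t ≤ B.smax * τ := mul_le_mul_of_nonneg_left htτ hsm.le
      linarith [b1, b2]
    have eJ : s * J = s * I₀ + s * (J - I₀) := by ring
    have hb : |s * (J - I₀)| ≤ 3 * B.smax * τ := by rw [abs_mul, hsabs, one_mul]; exact hJI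
    have hb' := neg_abs_le (s * (J - I₀))
    rw [eJ]; linarith [hI]
  have hsσ : s = σ' := by
    rcases hs01 with rfl | rfl <;> rcases hσ' with rfl | rfl
    · rfl
    · exfalso; linarith
    · exfalso; linarith
    · rfl
  -- (2) the core, with the sign kept
  have hHess := B.hess_ge μ hμ ξ
  have hid := sin_mul_acc_eq_neg_hess h1 h2 ξ
  have bR1 : |σ' * Real.sin Sx - Real.sin (bandX μ ξ)| * |bandAX μ ξ| ≤ ε₃ * B.A2 :=
    mul_le_mul cx (B.abs_AX_le μ hμ ξ) (abs_nonneg _) hε₃0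
  have bR2 : |σ' * Real.sin Sy - Real.sin (bandY μ ξ)| * |bandAY μ ξ| ≤ ε₃ * B.A2 :=
    mul_le_mul cy (B.abs_AY_le μ hμ ξ) (abs_nonneg _) hε₃0
  have hcore : σ' * (Real.sin Sx * bandAX μ ξ + Real.sin Sy * bandAY μ ξ) ≤ -(B.hmin / 2) := by
    have e1 : σ' * (Real.sin Sx * bandAX μ ξ + Real.sin Sy * bandAY μ ξ) =
        (Real.sin (bandX μ ξ) * bandAX μ ξ + Real.sin (bandY μ ξ) * bandAY μ ξ) +
        ((σ' * Real.sin Sx - Real.sin (bandX μ ξ)) * bandAX μ ξ + (σ' * Real.sin Sy - Real.sin (bandY μ ξ)) * bandAY μ ξ) := by ring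
    have hR : |(σ' * Real.sin Sx - Real.sin (bandX μ ξ)) * bandAX μ ξ + (σ' * Real.sin Sy - Real.sin (bandY μ ξ)) * bandAY μ ξ| ≤
        ε₃ * B.A2 + ε₃ * B.A2 := by
      refine (abs_add_le _ _).trans ?_
      rw [abs_mul, abs_mul]; exact add_le_add bR1 bR2
    have hR' := le_abs_self ((σ' * Real.sin Sx - Real.sin (bandX μ ξ)) * bandAX μ ξ + (σ' * Real.sin Sy - Real.sin (bandY μ ξ)) * bandAY μ ξ)
    have hsm2 : 2 * (ε₃ * B.A2) ≤ B.hmin / 2 := by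
      have e3 : 2 * (ε₃ * B.A2) =
          2 * B.A2 * (η₀ / B.Dtmin + B.smax * (B.Cg * (lam + B.A2 * τ + 2 * B.smax * (η₀ / B.Dtmin)) + τ / 2)) := by
        rw [hε₃, hε₂]; ring
      rw [e3]; exact hsmall
    rw [e1, hid]; linarith
  rw [hsσ, hval, show σ' * (t * (Real.sin Sx * bandAX μ ξ + Real.sin Sy * bandAY μ ξ)) =
    t * (σ' * (Real.sin Sx * bandAX μ ξ + Real.sin Sy * bandAY μ ξ)) by ring]
  have := mul_le_mul_of_nonneg_left hcore ht0.le
  linarith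

/-- **Row kill, anti-aligned (corner-type) row.**  If the diagonal value `D(σ) = h(σ,σ)` satisfies `δ₀ + δ₁τ < D(σ) ≤ η₀/2`, the diagonal slope
`|G(σ, 0)| ≤ 2λ`, the alignment functional is negative with margin (`ι ≤ −I₀(σ)`, `3s_max τ < ι`), and `2A₂τ² ≤ η₀/2`, `(8s_max² + 4A₂)τ ≤ 2λ` (so the key
hypotheses hold on the whole row), then along the row `F` is increasing on `[0, τ]` and NO cell `t = (i+1)w`, `i < ⌊τ/w⌋`, has `|F(t)| ≤ δ₀ + δ₁t`.
[cite: BenfattoGiulianiMastropietro2006, App. A2] -/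
theorem row_kill_anti {θ₁ σ w τ η₀ lam ι δ₀ δ₁ : ℝ} (hw : 0 < w) (hτ : 0 < τ) (hδ₀ : 0 ≤ δ₀) (hδ₁ : 0 ≤ δ₁)
    (hlo : a ≤ μ - η₀) (hhi : μ + η₀ ≤ b)
    (hsmall : 2 * B.A2 * (η₀ / B.Dtmin + B.smax * (B.Cg * (lam + B.A2 * τ + 2 * B.smax * (η₀ / B.Dtmin)) + τ / 2)) ≤ B.hmin / 2)
    (hρ : 2 * (η₀ / B.Dtmin + B.smax * (B.Cg * (lam + B.A2 * τ + 2 * B.smax * (η₀ / B.Dtmin)) + τ / 2)) < B.rhomin ^ 2)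
    (hτη : 2 * B.A2 * τ ^ 2 ≤ η₀ / 2) (hτlam : (8 * B.smax ^ 2 + 4 * B.A2) * τ ≤ 2 * lam)
    (hDlo : δ₀ + δ₁ * τ < hfun μ θ₁ σ σ) (hDhi : hfun μ θ₁ σ σ ≤ η₀ / 2) (hG0 : |Gfun μ θ₁ σ 0| ≤ 2 * lam)
    (hI : ι ≤ -(Real.sin (SX μ θ₁ σ σ) * Real.sin (bandX μ σ) + Real.sin (SY μ θ₁ σ σ) * Real.sin (bandY μ σ)))
    (hι : 3 * B.smax * τ < ι) :
    ((Finset.range ⌊τ / w⌋₊).filter fun i : ℕ =>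
        |hfun μ θ₁ (σ - (w + i * w) / 2) (σ + (w + i * w) / 2)| ≤ δ₀ + δ₁ * (w + i * w)).card = 0 := by
  obtain ⟨h1, h2⟩ := B.level hμ
  have hA := B.A2_pos; have hsm := B.smax_pos
  set F : ℝ → ℝ := fun t => hfun μ θ₁ (σ - t / 2) (σ + t / 2) with hF
  set F' : ℝ → ℝ := fun t => Real.sin (SX μ θ₁ (σ - t / 2) (σ + t / 2)) * (bandVX μ (σ + t / 2) - bandVX μ (σ - t / 2)) +
        Real.sin (SY μ θ₁ (σ - t / 2) (σ + t / 2)) * (bandVY μ (σ + t / 2) - bandVY μ (σ - t / 2)) with hF'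
  have hFd : ∀ t, HasDerivAt F (F' t) t := hasDerivAt_hfun_anti h1 h2 θ₁ σ
  have hF0 : F 0 = hfun μ θ₁ σ σ := by simp only [hF, zero_div, sub_zero, add_zero]
  have hδτ : 0 ≤ δ₁ * τ := by positivity
  -- on the whole row: `|F t| ≤ η₀` and `|G t| ≤ 4λ`
  have hrow : ∀ t, 0 ≤ t → t ≤ τ → |F t| ≤ η₀ ∧ |Gfun μ θ₁ σ t| ≤ 4 * lam := by
    intro t ht0 htτ
    have hbd : ∀ s ∈ Icc 0 t, |F' s| ≤ 2 * B.A2 * τ := fun s hs =>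
      (abs_anti_deriv_le B hμ θ₁ σ s).trans (by rw [abs_of_nonneg hs.1]; nlinarith [hs.2])
    have hvar := abs_sub_le_of_abs_deriv_le hFd hbd (z := t) ⟨ht0, le_rfl⟩
    have hFt : |F t| ≤ η₀ := by
      have := abs_sub_abs_le_abs_sub (F t) (F 0)
      have hF0' : |F 0| ≤ η₀ / 2 := by
        rw [hF0, abs_le]; constructor <;> linarith
      have hq : 2 * B.A2 * τ * (t - 0) ≤ 2 * B.A2 * τ ^ 2 := by
        rw [sub_zero, pow_two, ← mul_assoc]; exact mul_le_mul_of_nonneg_left htτ (by positivity)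
      linarith
    have hGt : |Gfun μ θ₁ σ t| ≤ 4 * lam := by
      have hg := abs_Gfun_sub_le B hμ θ₁ σ t 0
      rw [sub_zero, abs_of_nonneg ht0] at hg
      have := abs_sub_abs_le_abs_sub (Gfun μ θ₁ σ t) (Gfun μ θ₁ σ 0)
      have hq : (8 * B.smax ^ 2 + 4 * B.A2) * t ≤ (8 * B.smax ^ 2 + 4 * B.A2) * τ :=
        mul_le_mul_of_nonneg_left htτ (by positivity)
      linarith
    exact ⟨hFt, hGt⟩
  -- hence `F' ≥ 0` on `[0, τ]`
  have hmono : ∀ t, 0 ≤ t → t ≤ τ → 0 ≤ F' t := by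
    intro t ht0 htτ
    rcases eq_or_lt_of_le ht0 with h0 | hpos
    · rw [← h0, hF']; simp only [zero_div, sub_zero, add_zero, sub_self, mul_zero]; exact le_rfl
    · obtain ⟨hFt, hGt⟩ := hrow t ht0 htτ
      have := even_key_signed B hμ (s := -1) (Or.inr rfl) hpos htτ hlo hhi hFt hGt hsmall hρ (by linarith [hI]) hι
      have hh := B.hmin_pos
      rw [hF']; nlinarith
  -- `δ₀ < F 0` and monotone filter
  have hδ₀F : δ₀ + δ₁ * τ < F 0 := by rw [hF0]; exact hDlo
  have hK : ((⌊τ / w⌋₊ : ℕ) : ℝ) * w ≤ τ := by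
    have := Nat.floor_le (div_nonneg hτ.le hw.le) (a := τ / w)
    rwa [le_div_iff₀ hw] at this
  have hzero := gridCount_oneSided_incr hFd hmono hδ₀F hw hK
  rw [Finset.card_eq_zero, Finset.filter_eq_empty_iff] at hzero ⊢
  intro i hi hle
  refine hzero hi (hle.trans ?_)
  have hi' : (i : ℝ) + 1 ≤ ⌊τ / w⌋₊ := by exact_mod_cast Nat.succ_le_of_lt (Finset.mem_range.1 hi)
  have hiw : w + i * w ≤ τ := by nlinarith [hi', hK, hw.le]
  linarith [mul_le_mul_of_nonneg_left hiw hδ₁]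

/-- **Row kill, aligned (forward-type sign) row below the band**: the mirror of `row_kill_anti` — `D(σ) < −(δ₀ + δ₁τ)`, `−η₀/2 ≤ D(σ)`, `ι ≤ I₀(σ)`:
`F` is decreasing on `[0, τ]` and no cell of the row is admissible. [cite: BenfattoGiulianiMastropietro2006, App. A2] -/
theorem row_kill_aligned {θ₁ σ w τ η₀ lam ι δ₀ δ₁ : ℝ} (hw : 0 < w) (hτ : 0 < τ) (hδ₀ : 0 ≤ δ₀) (hδ₁ : 0 ≤ δ₁)
    (hlo : a ≤ μ - η₀) (hhi : μ + η₀ ≤ b)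
    (hsmall : 2 * B.A2 * (η₀ / B.Dtmin + B.smax * (B.Cg * (lam + B.A2 * τ + 2 * B.smax * (η₀ / B.Dtmin)) + τ / 2)) ≤ B.hmin / 2)
    (hρ : 2 * (η₀ / B.Dtmin + B.smax * (B.Cg * (lam + B.A2 * τ + 2 * B.smax * (η₀ / B.Dtmin)) + τ / 2)) < B.rhomin ^ 2)
    (hτη : 2 * B.A2 * τ ^ 2 ≤ η₀ / 2) (hτlam : (8 * B.smax ^ 2 + 4 * B.A2) * τ ≤ 2 * lam)
    (hDhi : hfun μ θ₁ σ σ < -(δ₀ + δ₁ * τ)) (hDlo : -(η₀ / 2) ≤ hfun μ θ₁ σ σ) (hG0 : |Gfun μ θ₁ σ 0| ≤ 2 * lam)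
    (hI : ι ≤ Real.sin (SX μ θ₁ σ σ) * Real.sin (bandX μ σ) + Real.sin (SY μ θ₁ σ σ) * Real.sin (bandY μ σ))
    (hι : 3 * B.smax * τ < ι) :
    ((Finset.range ⌊τ / w⌋₊).filter fun i : ℕ =>
        |hfun μ θ₁ (σ - (w + i * w) / 2) (σ + (w + i * w) / 2)| ≤ δ₀ + δ₁ * (w + i * w)).card = 0 := by
  obtain ⟨h1, h2⟩ := B.level hμ
  have hA := B.A2_pos; have hsm := B.smax_pos
  set F : ℝ → ℝ := fun t => hfun μ θ₁ (σ - t / 2) (σ + t / 2) with hF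
  set F' : ℝ → ℝ := fun t => Real.sin (SX μ θ₁ (σ - t / 2) (σ + t / 2)) * (bandVX μ (σ + t / 2) - bandVX μ (σ - t / 2)) +
        Real.sin (SY μ θ₁ (σ - t / 2) (σ + t / 2)) * (bandVY μ (σ + t / 2) - bandVY μ (σ - t / 2)) with hF'
  have hFd : ∀ t, HasDerivAt F (F' t) t := hasDerivAt_hfun_anti h1 h2 θ₁ σ
  have hF0 : F 0 = hfun μ θ₁ σ σ := by simp only [hF, zero_div, sub_zero, add_zero]
  have hδτ : 0 ≤ δ₁ * τ := by positivity
  have hrow : ∀ t, 0 ≤ t → t ≤ τ → |F t| ≤ η₀ ∧ |Gfun μ θ₁ σ t| ≤ 4 * lam := by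
    intro t ht0 htτ
    have hbd : ∀ s ∈ Icc 0 t, |F' s| ≤ 2 * B.A2 * τ := fun s hs =>
      (abs_anti_deriv_le B hμ θ₁ σ s).trans (by rw [abs_of_nonneg hs.1]; nlinarith [hs.2])
    have hvar := abs_sub_le_of_abs_deriv_le hFd hbd (z := t) ⟨ht0, le_rfl⟩
    have hFt : |F t| ≤ η₀ := by
      have := abs_sub_abs_le_abs_sub (F t) (F 0)
      have hF0' : |F 0| ≤ η₀ / 2 := by
        rw [hF0, abs_le]; constructor <;> linarith
      have hq : 2 * B.A2 * τ * (t - 0) ≤ 2 * B.A2 * τ ^ 2 := by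
        rw [sub_zero, pow_two, ← mul_assoc]; exact mul_le_mul_of_nonneg_left htτ (by positivity)
      linarith
    have hGt : |Gfun μ θ₁ σ t| ≤ 4 * lam := by
      have hg := abs_Gfun_sub_le B hμ θ₁ σ t 0
      rw [sub_zero, abs_of_nonneg ht0] at hg
      have := abs_sub_abs_le_abs_sub (Gfun μ θ₁ σ t) (Gfun μ θ₁ σ 0)
      have hq : (8 * B.smax ^ 2 + 4 * B.A2) * t ≤ (8 * B.smax ^ 2 + 4 * B.A2) * τ :=
        mul_le_mul_of_nonneg_left htτ (by positivity)
      linarith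
    exact ⟨hFt, hGt⟩
  have hmono : ∀ t, 0 ≤ t → t ≤ τ → F' t ≤ 0 := by
    intro t ht0 htτ
    rcases eq_or_lt_of_le ht0 with h0 | hpos
    · rw [← h0, hF']; simp only [zero_div, sub_zero, add_zero, sub_self, mul_zero]; exact le_rfl
    · obtain ⟨hFt, hGt⟩ := hrow t ht0 htτ
      have := even_key_signed B hμ (s := 1) (Or.inl rfl) hpos htτ hlo hhi hFt hGt hsmall hρ (by linarith [hI]) hι
      have hh := B.hmin_pos
      rw [hF']; nlinarith
  have hδ₀F : F 0 < -(δ₀ + δ₁ * τ) := by rw [hF0]; exact hDhi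
  have hK : ((⌊τ / w⌋₊ : ℕ) : ℝ) * w ≤ τ := by
    have := Nat.floor_le (div_nonneg hτ.le hw.le) (a := τ / w)
    rwa [le_div_iff₀ hw] at this
  have hzero := gridCount_oneSided_decr hFd hmono hδ₀F hw hK
  rw [Finset.card_eq_zero, Finset.filter_eq_empty_iff] at hzero ⊢
  intro i hi hle
  refine hzero hi (hle.trans ?_)
  have hi' : (i : ℝ) + 1 ≤ ⌊τ / w⌋₊ := by exact_mod_cast Nat.succ_le_of_lt (Finset.mem_range.1 hi)
  have hiw : w + i * w ≤ τ := by nlinarith [hi', hK, hw.le]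
  linarith [mul_le_mul_of_nonneg_left hiw hδ₁]

end Signed

end Literature.MathematicalPhysics.QuantumLattice.BandSectorCounting

end
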